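import Mathlib
import HarnessLib
import Summits.NavierStokesRegularity.NavierStokesRegularity.Theorems.PoloidalWindowDoorLrcModEntireCurvedWebHuygens

/-!
# Route `PoloidalWindowDoor`, item `LrcModEntire` (stmt-NavierStokesRegularity-20428), cell (Q4-curved) of the (TH) column —
# B-CRc: CAUCHY–RIEMANN WITH TRACE ON A CURVED WEB SHEET (moving Fermi frame)

Cell ns-regularity-ideate, helper seat ns-k2-port-2 g9 under the LEAD of item 20428 (ns-poloidal-K2-p3 g17, memo `Cruxes/LrcModEntire/T2B-g17.md`
§6(6a) equations (1′)(2′), §6(6e) brick «B-CRc (curved sheet CR with trace, class-free, S — the straight `…Q4SonicSheetCR` plus the frame rotation)»);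
`--supports stmt-NavierStokesRegularity-20428 --as helper`.  Class-free chain-rule identities; the straight case (`k ≡ 0`, fixed frame) is LEAD g17's
`…Q4SonicSheetCR.sheet_CR_fst/sheet_CR_snd`.

Setting: a vector field `u : ℝ³ → ℝ³` differentiable at the web point (the slice `U(−1,·)`); a `C²` planar branch `Γ` with Frenet law `Γ″ = k•JΓ′`
(`J = rotJ`; unit speed is not needed for the identities); an offset `d` differentiable at the height `z`; the CURVED PARALLEL WEB MAP
`W(s,z) = Γ(s) + d(z)·JΓ′(s) + z·e₂` (K2-p2 g16's `…CurvedWebHuygens` with web function `G(s,z) = d(z)`), Fermi factor `1 − k(s)d(z)`.  The MOVING-FRAME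
sheet components are `f_T(s,z) = ⟪u(W(s,z)), Γ′(s)⟫` and `f_ν(s,z) = ⟪u(W(s,z)), JΓ′(s)⟫`.  With `x = W(s,z)`, `T = Γ′(s)`, `ν = JΓ′(s)`:

* `fderiv_tangentComponent` — `D f_T[h] = h₁(1 − kd)⟪Du(x)T, T⟫ + d′h₂⟪Du(x)ν, T⟫ + h₂⟪Du(x)e₂, T⟫ + h₁k⟪u(x), ν⟫`;
* `fderiv_normalComponent` — `D f_ν[h] = h₁(1 − kd)⟪Du(x)T, ν⟫ + d′h₂⟪Du(x)ν, ν⟫ + h₂⟪Du(x)e₂, ν⟫ − h₁k⟪u(x), T⟫`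
  (the frame turns: `Γ′′ = kJΓ′`, `(JΓ′)′ = −kΓ′`).

At a web point carrying the three POINT identities of the (TH) sheet — vanishing vertical derivative of the horizontal velocity (`⟪Du(x)e₂, T⟫ = ⟪Du(x)e₂, ν⟫ = 0`:
slab law `∂₂U_b = μ∂_bU₂` at a horizontally critical point of `U₂`), symmetric horizontal block (`⟪Du(x)T, ν⟫ = ⟪Du(x)ν, T⟫`: poloidal) with trace `c`
(`= −∂₂U₂(x)`) — this gives the CURVED CAUCHY–RIEMANN PAIR WITH TRACE (division-free forms):

* `curvedSheet_CR_fst` — `d′·(∂_s f_ν + k f_T) = (1 − kd)·∂_z f_T`;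
* `curvedSheet_CR_snd` — `(1 − kd)·∂_z f_ν = d′·((1 − kd)c − ∂_s f_T + k f_ν)`;

and, where `d′(z) ≠ 0` (so that `∂_m = d′⁻¹∂_z` along the Fermi distance `m = d(z)`), the memo's equations (1′)(2′) for `h := f_ν`, `P := f_T`, `J := 1 − kd`:

* `curvedSheet_CR_fst'` — **`∂_s h = J·(∂_z P / d′) − k·P`**   ((1′) `h_s = J P_m − k P`);
* `curvedSheet_CR_snd'` — **`∂_s P = −J·(∂_z h / d′) + k·h + J·c`**   ((2′) `P_s = −J h_m + k h + 2Jτ`, `c = 2τ`).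

WHAT THIS IS NOT: not a claim about Navier–Stokes regularity and not a stub of the registry; class-free calculus for the residual research cells
`stub_Q4curvedAperiodic` / `stub_Q4sonicLineNegIsolated` of `Cruxes/LrcModEntire/Lines/twist_split.lean` (bears_on LADDER-NS N0 via item 20428; items
20428 / 19708 / 27893 OPEN).
-/

noncomputable section

set_option linter.dupNamespace false

namespace Summit.NavierStokesRegularity.NavierStokesRegularity.Theorems.PoloidalWindowDoorLrcModEntireCurvedSheetCR

open Set Function Filter Topology
open scoped RealInnerProductSpace InnerProductSpace
open Summit.NavierStokesRegularity.NavierStokesRegularity.Theorems.PoloidalWindowDoorLrcModEntireSheetFlattenTools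
open Summit.NavierStokesRegularity.NavierStokesRegularity.Theorems.PoloidalWindowDoorLrcModEntireRidgeGlobalBranchFrame
open Summit.NavierStokesRegularity.NavierStokesRegularity.Theorems.PoloidalWindowDoorLrcModEntirePlanarCurveRigidity
open Summit.NavierStokesRegularity.NavierStokesRegularity.Theorems.PoloidalWindowDoorLrcModEntireCurvedWebHuygens

variable {u : EuclideanSpace ℝ (Fin 3) → EuclideanSpace ℝ (Fin 3)} {Γ : ℝ → EuclideanSpace ℝ (Fin 3)} {k d : ℝ → ℝ} {p : ℝ × ℝ}

/-- The parallel offset `G(s,z) = d(z)` as a web function: differentiable where `d` is, with `DG[h] = d′(z)·h₂`. -/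
theorem hasFDerivAt_offset (hd : DifferentiableAt ℝ d p.2) :
    HasFDerivAt (fun q : ℝ × ℝ => d q.2)
      ((ContinuousLinearMap.smulRight (1 : ℝ →L[ℝ] ℝ) (deriv d p.2)).comp (ContinuousLinearMap.snd ℝ ℝ ℝ)) p :=
  hd.hasDerivAt.hasFDerivAt.comp p hasFDerivAt_snd

/-- `DG(p)[h] = d′(p₂)·h₂` for the parallel offset. -/
theorem fderiv_offset_apply (hd : DifferentiableAt ℝ d p.2) (h : ℝ × ℝ) :
    fderiv ℝ (fun q : ℝ × ℝ => d q.2) p h = deriv d p.2 * h.2 := by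
  rw [(hasFDerivAt_offset hd).fderiv]
  simp [mul_comm]

/-- The derivative of the FIXED-direction sheet component `q ↦ ⟪u(W q), a⟫` along `h`:
`h₁(1 − kd)⟪Du(x)T, a⟫ + d′h₂⟪Du(x)ν, a⟫ + h₂⟪Du(x)e₂, a⟫`. -/
theorem fderiv_fixedComponent (hΓ : ContDiff ℝ 2 Γ) (hpl : ∀ s, Γ s 2 = 0)
    (hk : ∀ s, deriv (deriv Γ) s = k s • rotJ (deriv Γ s)) (hd : DifferentiableAt ℝ d p.2)
    (hu : DifferentiableAt ℝ u (Γ p.1 + d p.2 • rotJ (deriv Γ p.1) + p.2 • e2))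
    (a : EuclideanSpace ℝ (Fin 3)) (h : ℝ × ℝ) :
    fderiv ℝ (fun q : ℝ × ℝ => ⟪u (Γ q.1 + d q.2 • rotJ (deriv Γ q.1) + q.2 • e2), a⟫) p h =
      h.1 * (1 - k p.1 * d p.2) * ⟪fderiv ℝ u (Γ p.1 + d p.2 • rotJ (deriv Γ p.1) + p.2 • e2) (deriv Γ p.1), a⟫ +
        deriv d p.2 * h.2 * ⟪fderiv ℝ u (Γ p.1 + d p.2 • rotJ (deriv Γ p.1) + p.2 • e2) (rotJ (deriv Γ p.1)), a⟫ +
          h.2 * ⟪fderiv ℝ u (Γ p.1 + d p.2 • rotJ (deriv Γ p.1) + p.2 • e2) e2, a⟫ := by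
  have hG : DifferentiableAt ℝ (fun q : ℝ × ℝ => d q.2) p := (hasFDerivAt_offset hd).differentiableAt
  set x := Γ p.1 + d p.2 • rotJ (deriv Γ p.1) + p.2 • e2 with hx
  have hg : DifferentiableAt ℝ (fun y => ⟪u y, a⟫) x := hu.inner ℝ (differentiableAt_const a)
  have hg' : ∀ v, fderiv ℝ (fun y => ⟪u y, a⟫) x v = ⟪fderiv ℝ u x v, a⟫ := by
    intro v
    rw [fderiv_inner_apply ℝ hu (differentiableAt_const a)]
    simp
  have hc := fderiv_comp_curvedWeb hΓ hpl hk (G := fun q : ℝ × ℝ => d q.2) hG (g := fun y => ⟪u y, a⟫) hg h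
  rw [hc, hg', fderiv_offset_apply hd h]
  simp only [map_add, map_smul, inner_add_left, inner_smul_left, conj_trivial]

/-- **The derivative of the TANGENTIAL sheet component** `f_T(q) = ⟪u(W q), Γ′(q₁)⟫`:
`D f_T[h] = h₁(1 − kd)⟪Du T, T⟫ + d′h₂⟪Du ν, T⟫ + h₂⟪Du e₂, T⟫ + h₁ k ⟪u, ν⟫` (the frame turns: `Γ″ = kν`). -/
theorem fderiv_tangentComponent (hΓ : ContDiff ℝ 2 Γ) (hpl : ∀ s, Γ s 2 = 0)
    (hk : ∀ s, deriv (deriv Γ) s = k s • rotJ (deriv Γ s)) (hd : DifferentiableAt ℝ d p.2)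
    (hu : DifferentiableAt ℝ u (Γ p.1 + d p.2 • rotJ (deriv Γ p.1) + p.2 • e2)) (h : ℝ × ℝ) :
    fderiv ℝ (fun q : ℝ × ℝ => ⟪u (Γ q.1 + d q.2 • rotJ (deriv Γ q.1) + q.2 • e2), deriv Γ q.1⟫) p h =
      h.1 * (1 - k p.1 * d p.2) * ⟪fderiv ℝ u (Γ p.1 + d p.2 • rotJ (deriv Γ p.1) + p.2 • e2) (deriv Γ p.1), deriv Γ p.1⟫ +
        deriv d p.2 * h.2 * ⟪fderiv ℝ u (Γ p.1 + d p.2 • rotJ (deriv Γ p.1) + p.2 • e2) (rotJ (deriv Γ p.1)), deriv Γ p.1⟫ +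
          h.2 * ⟪fderiv ℝ u (Γ p.1 + d p.2 • rotJ (deriv Γ p.1) + p.2 • e2) e2, deriv Γ p.1⟫ +
            h.1 * k p.1 * ⟪u (Γ p.1 + d p.2 • rotJ (deriv Γ p.1) + p.2 • e2), rotJ (deriv Γ p.1)⟫ := by
  have hG : DifferentiableAt ℝ (fun q : ℝ × ℝ => d q.2) p := (hasFDerivAt_offset hd).differentiableAt
  set W : ℝ × ℝ → EuclideanSpace ℝ (Fin 3) := fun q => Γ q.1 + d q.2 • rotJ (deriv Γ q.1) + q.2 • e2 with hW
  have hWd : DifferentiableAt ℝ W p := differentiableAt_curvedWeb hΓ hpl hk hG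
  have huW : DifferentiableAt ℝ (fun q => u (W q)) p := hu.comp p hWd
  have hT := hasFDerivAt_tangent_fst hΓ hk p
  have hTd : DifferentiableAt ℝ (fun q : ℝ × ℝ => deriv Γ q.1) p := hT.differentiableAt
  have h1 : fderiv ℝ (fun q : ℝ × ℝ => ⟪u (W q), deriv Γ q.1⟫) p h =
      ⟪u (W p), fderiv ℝ (fun q : ℝ × ℝ => deriv Γ q.1) p h⟫ + ⟪fderiv ℝ (fun q => u (W q)) p h, deriv Γ p.1⟫ := by
    rw [fderiv_inner_apply ℝ huW hTd]
  -- the second term is the fixed-direction derivative with `a = Γ′(s)`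
  have h2 : ⟪fderiv ℝ (fun q => u (W q)) p h, deriv Γ p.1⟫ =
      fderiv ℝ (fun q : ℝ × ℝ => ⟪u (W q), deriv Γ p.1⟫) p h := by
    rw [fderiv_inner_apply ℝ huW (differentiableAt_const _)]
    simp
  rw [h1, h2, hT.fderiv]
  have h3 := fderiv_fixedComponent hΓ hpl hk hd hu (deriv Γ p.1) h
  simp only [hW] at h3 ⊢
  rw [h3]
  simp only [ContinuousLinearMap.comp_apply, ContinuousLinearMap.coe_fst', ContinuousLinearMap.smulRight_apply,
    ContinuousLinearMap.one_def, ContinuousLinearMap.id_apply, inner_smul_right]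
  ring

/-- **The derivative of the NORMAL sheet component** `f_ν(q) = ⟪u(W q), JΓ′(q₁)⟫`:
`D f_ν[h] = h₁(1 − kd)⟪Du T, ν⟫ + d′h₂⟪Du ν, ν⟫ + h₂⟪Du e₂, ν⟫ − h₁ k ⟪u, T⟫` (the frame turns: `(JΓ′)′ = −kΓ′`). -/
theorem fderiv_normalComponent (hΓ : ContDiff ℝ 2 Γ) (hpl : ∀ s, Γ s 2 = 0)
    (hk : ∀ s, deriv (deriv Γ) s = k s • rotJ (deriv Γ s)) (hd : DifferentiableAt ℝ d p.2)
    (hu : DifferentiableAt ℝ u (Γ p.1 + d p.2 • rotJ (deriv Γ p.1) + p.2 • e2)) (h : ℝ × ℝ) :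
    fderiv ℝ (fun q : ℝ × ℝ => ⟪u (Γ q.1 + d q.2 • rotJ (deriv Γ q.1) + q.2 • e2), rotJ (deriv Γ q.1)⟫) p h =
      h.1 * (1 - k p.1 * d p.2) * ⟪fderiv ℝ u (Γ p.1 + d p.2 • rotJ (deriv Γ p.1) + p.2 • e2) (deriv Γ p.1), rotJ (deriv Γ p.1)⟫ +
        deriv d p.2 * h.2 * ⟪fderiv ℝ u (Γ p.1 + d p.2 • rotJ (deriv Γ p.1) + p.2 • e2) (rotJ (deriv Γ p.1)), rotJ (deriv Γ p.1)⟫ +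
          h.2 * ⟪fderiv ℝ u (Γ p.1 + d p.2 • rotJ (deriv Γ p.1) + p.2 • e2) e2, rotJ (deriv Γ p.1)⟫ -
            h.1 * k p.1 * ⟪u (Γ p.1 + d p.2 • rotJ (deriv Γ p.1) + p.2 • e2), deriv Γ p.1⟫ := by
  have hG : DifferentiableAt ℝ (fun q : ℝ × ℝ => d q.2) p := (hasFDerivAt_offset hd).differentiableAt
  set W : ℝ × ℝ → EuclideanSpace ℝ (Fin 3) := fun q => Γ q.1 + d q.2 • rotJ (deriv Γ q.1) + q.2 • e2 with hW
  have hWd : DifferentiableAt ℝ W p := differentiableAt_curvedWeb hΓ hpl hk hG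
  have huW : DifferentiableAt ℝ (fun q => u (W q)) p := hu.comp p hWd
  have hN := hasFDerivAt_normal_fst hΓ hpl hk p
  have hNd : DifferentiableAt ℝ (fun q : ℝ × ℝ => rotJ (deriv Γ q.1)) p := hN.differentiableAt
  have h1 : fderiv ℝ (fun q : ℝ × ℝ => ⟪u (W q), rotJ (deriv Γ q.1)⟫) p h =
      ⟪u (W p), fderiv ℝ (fun q : ℝ × ℝ => rotJ (deriv Γ q.1)) p h⟫ + ⟪fderiv ℝ (fun q => u (W q)) p h, rotJ (deriv Γ p.1)⟫ := by
    rw [fderiv_inner_apply ℝ huW hNd]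
  have h2 : ⟪fderiv ℝ (fun q => u (W q)) p h, rotJ (deriv Γ p.1)⟫ =
      fderiv ℝ (fun q : ℝ × ℝ => ⟪u (W q), rotJ (deriv Γ p.1)⟫) p h := by
    rw [fderiv_inner_apply ℝ huW (differentiableAt_const _)]
    simp
  rw [h1, h2, hN.fderiv]
  have h3 := fderiv_fixedComponent hΓ hpl hk hd hu (rotJ (deriv Γ p.1)) h
  simp only [hW] at h3 ⊢
  rw [h3]
  simp only [ContinuousLinearMap.comp_apply, ContinuousLinearMap.coe_fst', ContinuousLinearMap.smulRight_apply,
    ContinuousLinearMap.one_def, ContinuousLinearMap.id_apply, inner_smul_right]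
  ring

/-- **CURVED CAUCHY–RIEMANN, first identity (division-free):** `d′·(∂_s f_ν + k f_T) = (1 − kd)·∂_z f_T`
(both sides equal `(1 − kd)·d′·⟪Du T, ν⟫`). -/
theorem curvedSheet_CR_fst (hΓ : ContDiff ℝ 2 Γ) (hpl : ∀ s, Γ s 2 = 0)
    (hk : ∀ s, deriv (deriv Γ) s = k s • rotJ (deriv Γ s)) (hd : DifferentiableAt ℝ d p.2)
    (hu : DifferentiableAt ℝ u (Γ p.1 + d p.2 • rotJ (deriv Γ p.1) + p.2 • e2))
    (hz : ⟪fderiv ℝ u (Γ p.1 + d p.2 • rotJ (deriv Γ p.1) + p.2 • e2) e2, deriv Γ p.1⟫ = 0)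
    (hcurl : ⟪fderiv ℝ u (Γ p.1 + d p.2 • rotJ (deriv Γ p.1) + p.2 • e2) (deriv Γ p.1), rotJ (deriv Γ p.1)⟫ =
      ⟪fderiv ℝ u (Γ p.1 + d p.2 • rotJ (deriv Γ p.1) + p.2 • e2) (rotJ (deriv Γ p.1)), deriv Γ p.1⟫) :
    deriv d p.2 *
        (fderiv ℝ (fun q : ℝ × ℝ => ⟪u (Γ q.1 + d q.2 • rotJ (deriv Γ q.1) + q.2 • e2), rotJ (deriv Γ q.1)⟫) p ((1 : ℝ), (0 : ℝ)) +
          k p.1 * ⟪u (Γ p.1 + d p.2 • rotJ (deriv Γ p.1) + p.2 • e2), deriv Γ p.1⟫) =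
      (1 - k p.1 * d p.2) *
        fderiv ℝ (fun q : ℝ × ℝ => ⟪u (Γ q.1 + d q.2 • rotJ (deriv Γ q.1) + q.2 • e2), deriv Γ q.1⟫) p ((0 : ℝ), (1 : ℝ)) := by
  rw [fderiv_normalComponent hΓ hpl hk hd hu, fderiv_tangentComponent hΓ hpl hk hd hu, hz, hcurl]
  ring

/-- **CURVED CAUCHY–RIEMANN, second identity (division-free):** `(1 − kd)·∂_z f_ν = d′·((1 − kd)c − ∂_s f_T + k f_ν)`, `c` the horizontal trace
of `Du` at the web point (both sides equal `(1 − kd)·d′·⟪Du ν, ν⟫`). -/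
theorem curvedSheet_CR_snd (hΓ : ContDiff ℝ 2 Γ) (hpl : ∀ s, Γ s 2 = 0)
    (hk : ∀ s, deriv (deriv Γ) s = k s • rotJ (deriv Γ s)) (hd : DifferentiableAt ℝ d p.2)
    (hu : DifferentiableAt ℝ u (Γ p.1 + d p.2 • rotJ (deriv Γ p.1) + p.2 • e2))
    (hz : ⟪fderiv ℝ u (Γ p.1 + d p.2 • rotJ (deriv Γ p.1) + p.2 • e2) e2, rotJ (deriv Γ p.1)⟫ = 0)
    {c : ℝ} (hdiv : ⟪fderiv ℝ u (Γ p.1 + d p.2 • rotJ (deriv Γ p.1) + p.2 • e2) (deriv Γ p.1), deriv Γ p.1⟫ +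
      ⟪fderiv ℝ u (Γ p.1 + d p.2 • rotJ (deriv Γ p.1) + p.2 • e2) (rotJ (deriv Γ p.1)), rotJ (deriv Γ p.1)⟫ = c) :
    (1 - k p.1 * d p.2) *
        fderiv ℝ (fun q : ℝ × ℝ => ⟪u (Γ q.1 + d q.2 • rotJ (deriv Γ q.1) + q.2 • e2), rotJ (deriv Γ q.1)⟫) p ((0 : ℝ), (1 : ℝ)) =
      deriv d p.2 *
        ((1 - k p.1 * d p.2) * c -
            fderiv ℝ (fun q : ℝ × ℝ => ⟪u (Γ q.1 + d q.2 • rotJ (deriv Γ q.1) + q.2 • e2), deriv Γ q.1⟫) p ((1 : ℝ), (0 : ℝ)) +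
          k p.1 * ⟪u (Γ p.1 + d p.2 • rotJ (deriv Γ p.1) + p.2 • e2), rotJ (deriv Γ p.1)⟫) := by
  rw [fderiv_normalComponent hΓ hpl hk hd hu, fderiv_tangentComponent hΓ hpl hk hd hu, hz, ← hdiv]
  ring

/-- **(1′) of the memo:** where `d′(z) ≠ 0`, with `h := f_ν`, `P := f_T`, `J := 1 − kd`, `∂_m := d′⁻¹∂_z`:  **`∂_s h = J·(∂_z P)/d′ − k·P`**. -/
theorem curvedSheet_CR_fst' (hΓ : ContDiff ℝ 2 Γ) (hpl : ∀ s, Γ s 2 = 0)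
    (hk : ∀ s, deriv (deriv Γ) s = k s • rotJ (deriv Γ s)) (hd : DifferentiableAt ℝ d p.2) (hd0 : deriv d p.2 ≠ 0)
    (hu : DifferentiableAt ℝ u (Γ p.1 + d p.2 • rotJ (deriv Γ p.1) + p.2 • e2))
    (hz : ⟪fderiv ℝ u (Γ p.1 + d p.2 • rotJ (deriv Γ p.1) + p.2 • e2) e2, deriv Γ p.1⟫ = 0)
    (hcurl : ⟪fderiv ℝ u (Γ p.1 + d p.2 • rotJ (deriv Γ p.1) + p.2 • e2) (deriv Γ p.1), rotJ (deriv Γ p.1)⟫ =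
      ⟪fderiv ℝ u (Γ p.1 + d p.2 • rotJ (deriv Γ p.1) + p.2 • e2) (rotJ (deriv Γ p.1)), deriv Γ p.1⟫) :
    fderiv ℝ (fun q : ℝ × ℝ => ⟪u (Γ q.1 + d q.2 • rotJ (deriv Γ q.1) + q.2 • e2), rotJ (deriv Γ q.1)⟫) p ((1 : ℝ), (0 : ℝ)) =
      (1 - k p.1 * d p.2) *
          fderiv ℝ (fun q : ℝ × ℝ => ⟪u (Γ q.1 + d q.2 • rotJ (deriv Γ q.1) + q.2 • e2), deriv Γ q.1⟫) p ((0 : ℝ), (1 : ℝ)) / deriv d p.2 -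
        k p.1 * ⟪u (Γ p.1 + d p.2 • rotJ (deriv Γ p.1) + p.2 • e2), deriv Γ p.1⟫ := by
  have h := curvedSheet_CR_fst hΓ hpl hk hd hu hz hcurl
  field_simp
  linear_combination h

/-- **(2′) of the memo:** where `d′(z) ≠ 0`, with `h := f_ν`, `P := f_T`, `J := 1 − kd`, `c` the horizontal trace (`c = 2τ(m) = −∂₂U₂` on the sheet):
**`∂_s P = −J·(∂_z h)/d′ + k·h + J·c`**. -/
theorem curvedSheet_CR_snd' (hΓ : ContDiff ℝ 2 Γ) (hpl : ∀ s, Γ s 2 = 0)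
    (hk : ∀ s, deriv (deriv Γ) s = k s • rotJ (deriv Γ s)) (hd : DifferentiableAt ℝ d p.2) (hd0 : deriv d p.2 ≠ 0)
    (hu : DifferentiableAt ℝ u (Γ p.1 + d p.2 • rotJ (deriv Γ p.1) + p.2 • e2))
    (hz : ⟪fderiv ℝ u (Γ p.1 + d p.2 • rotJ (deriv Γ p.1) + p.2 • e2) e2, rotJ (deriv Γ p.1)⟫ = 0)
    {c : ℝ} (hdiv : ⟪fderiv ℝ u (Γ p.1 + d p.2 • rotJ (deriv Γ p.1) + p.2 • e2) (deriv Γ p.1), deriv Γ p.1⟫ +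
      ⟪fderiv ℝ u (Γ p.1 + d p.2 • rotJ (deriv Γ p.1) + p.2 • e2) (rotJ (deriv Γ p.1)), rotJ (deriv Γ p.1)⟫ = c) :
    fderiv ℝ (fun q : ℝ × ℝ => ⟪u (Γ q.1 + d q.2 • rotJ (deriv Γ q.1) + q.2 • e2), deriv Γ q.1⟫) p ((1 : ℝ), (0 : ℝ)) =
      -((1 - k p.1 * d p.2) *
          fderiv ℝ (fun q : ℝ × ℝ => ⟪u (Γ q.1 + d q.2 • rotJ (deriv Γ q.1) + q.2 • e2), rotJ (deriv Γ q.1)⟫) p ((0 : ℝ), (1 : ℝ)) / deriv d p.2) +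
        k p.1 * ⟪u (Γ p.1 + d p.2 • rotJ (deriv Γ p.1) + p.2 • e2), rotJ (deriv Γ p.1)⟫ + (1 - k p.1 * d p.2) * c := by
  have h := curvedSheet_CR_snd hΓ hpl hk hd hu hz hdiv
  field_simp
  linear_combination h

end Summit.NavierStokesRegularity.NavierStokesRegularity.Theorems.PoloidalWindowDoorLrcModEntireCurvedSheetCR

end
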